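import Mathlib

/-!
# Periodic solutions and the resolvent of the monodromy at `z = 1`

Algebraic core of the `z = 1` assembly (paper 24.105 (4), "bump identity"): for a linear evolution
with monodromy `M` and Duhamel term `ξ` (the forcing propagated over one period), the end value is
`M x + ξ`; the solution is periodic iff `x = (1 - M)⁻¹ ξ`, and then the periodic orbit's initial value
is bounded by `‖(1 - M)⁻¹‖ ‖ξ‖`.  This is why only the resolvent at `z = 1` enters `(P⁺)_F`
(kernel #185; replaces the withdrawn Chebyshev-identity proposal of the same number).
-/

namespace Summit.AnomalousDissipation.AnomalousDissipation.Theorems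

section algebra

variable {R V : Type*} [Ring R] [AddCommGroup V] [Module R V]

/-- Periodicity `M x + ξ = x` is equivalent to `x = (1 - M)⁻¹ ξ` whenever `1 - M` is a unit. -/
theorem periodic_iff_eq_resolvent (M : V →ₗ[R] V) (u : (V →ₗ[R] V)ˣ)
    (hu : (u : V →ₗ[R] V) = 1 - M) (x ξ : V) :
    M x + ξ = x ↔ x = ((u⁻¹ : (V →ₗ[R] V)ˣ) : V →ₗ[R] V) ξ := by
  have h1 : ∀ y : V, ((u⁻¹ : (V →ₗ[R] V)ˣ) : V →ₗ[R] V) ((u : V →ₗ[R] V) y) = y := fun y =>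
    DFunLike.congr_fun u.inv_mul y
  have h2 : ∀ y : V, (u : V →ₗ[R] V) (((u⁻¹ : (V →ₗ[R] V)ˣ) : V →ₗ[R] V) y) = y := fun y =>
    DFunLike.congr_fun u.mul_inv y
  have hux : (u : V →ₗ[R] V) x = x - M x := by rw [hu]; simp
  constructor
  · intro h
    have hξ : ξ = x - M x := by
      have := congrArg (fun v => v - M x) h
      simpa [add_sub_cancel_left] using this
    rw [hξ, ← hux, h1]
  · intro h
    have : (u : V →ₗ[R] V) x = ξ := by rw [h, h2]
    rw [hux] at this
    rw [← this]; abel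

end algebra

section bound

variable {V : Type*} [NormedAddCommGroup V] [NormedSpace ℝ V]

/-- Quantitative form: the periodic orbit's initial value obeys `‖x‖ ≤ ‖(1 - M)⁻¹‖ ‖ξ‖`
(operator norm of the inverse unit in the algebra of bounded operators). -/
theorem periodic_norm_le (M : V →L[ℝ] V) (u : (V →L[ℝ] V)ˣ) (hu : (u : V →L[ℝ] V) = 1 - M)
    (x ξ : V) (hper : M x + ξ = x) :
    ‖x‖ ≤ ‖((u⁻¹ : (V →L[ℝ] V)ˣ) : V →L[ℝ] V)‖ * ‖ξ‖ := by
  have hux : (u : V →L[ℝ] V) x = ξ := by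
    rw [hu]
    have : x - M x = ξ := by
      have := congrArg (fun v => v - M x) hper
      simp [add_sub_cancel_left] at this
      rw [← this]
    simpa using this
  have hx : x = ((u⁻¹ : (V →L[ℝ] V)ˣ) : V →L[ℝ] V) ξ := by
    rw [← hux]
    exact (DFunLike.congr_fun u.inv_mul x).symm
  calc ‖x‖ = ‖((u⁻¹ : (V →L[ℝ] V)ˣ) : V →L[ℝ] V) ξ‖ := by rw [← hx]
    _ ≤ ‖((u⁻¹ : (V →L[ℝ] V)ˣ) : V →L[ℝ] V)‖ * ‖ξ‖ := ContinuousLinearMap.le_opNorm _ _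

end bound

end Summit.AnomalousDissipation.AnomalousDissipation.Theorems
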